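import Summits.AtomisticToContinuum.BoseEinsteinCondensation.Theses.BECConjugateDomination
import Summits.AtomisticToContinuum.BoseEinsteinCondensation.Theorems.HardCoreExtension.Negative.HighDensityObstruction
import Summits.AtomisticToContinuum.BoseEinsteinCondensation.Theorems.HardCoreExtension.Negative.ScalingReductions
import Summits.AtomisticToContinuum.BoseEinsteinCondensation.Theorems.HardCoreExtension.Negative.UniformRepairNormalForm

/-!
# Line `third-law-current-floor` — skeleton for the crux `BECConjugateDomination.HardCoreExtension`
(crux item stmt-AtomisticToContinuum-11786, rank 5, route `route-AtomisticToContinuum-BECConjugateDomination`)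

Crux (FIXED, by name): `HardCoreExtension := A → BoseEinsteinCondensation`, `A` = dilute ground-state BEC for every
potential of the route's smooth class. Disproof.lean gen 2 §1: `¬crux ↔ A ∧ ¬B`, and any approximation proof has
the honest shape "`A` idle, `B` proved on the full class" (`IdeatorTwo.hardCoreExtension_of_uniform`,
`Ideator3.hardCoreExtension_of_periodicBEC_all`). This line is such a proof: the two reasons the route needed the
smooth class at all — Puff's cubic moment `m₃ = +∞` for a hard core, and `C³` positive minimisers — are removed by
ONE exact identity and ONE new infrared input, after which the route's chain runs on BOUNDED measurable potentials
with constants uniform in the potential at fixed range, and hard cores / shells / non-lsc profiles are reached by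
the bounded truncations `v_n = min(v, n) ↑ v` at fixed `(N, L)`.

Idea (card `Ideas/third-law-current-floor.md`, triage r1-1/2/3 + r1-3 gen 2: pass; merged with
`second-moment-floor-class-blind`): for every real periodic `C¹` state and every `k = 2πm/L ≠ 0`, with
`A := Σ_j e^{ik·x_j}(|k|²Ψ − 2i k·∇_jΨ)` (= `[H,ρ_k]Ψ`, no Laplacian), one integration by parts on the torus gives
`Re⟨ρ_kΨ, A⟩ = N|k|²` (f-sum rule of ONE state) and `‖A‖² = 4D_k + N|k|⁴(2 − S_k)`, `D_k = ‖Σ_j e^{ik·x_j}(k·∇_j)Ψ‖²`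
the longitudinal current fluctuation; Cauchy–Schwarz: `N|k|⁴(1−S_k)² ≤ 4 S_k D_k` (S1). Hence a FLOOR on the
structure factor `S_k ≥ min(½, |k|²/(16Cρ))` follows from ONE upper bound `D_k ≤ C ρ |k|² N` on the force structure
factor (S2, the load-bearing stub): finite for hard cores (first order in `∇Ψ`), anchored at `k = 0` by
`Σ_j ∇_jΨ = 0` (translation invariance = Newton's third law), Bogoliubov value `sup_k D_k/(N|k|²ρa) = 2.156 + 4π/3`.
This replaces `PuffFloor` in the route's glue; the quadratic (not linear) floor still closes the glue in `d = 3`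
because the lattice sum `Σ_{m≠0}|η̂(k/κ)|²/|k|² ≍ Vκ` converges at the origin (the dimension enters exactly here).

THE LINE (7 registered stubs, glued by `HardCoreExtension_of`; the antecedent `A` is idle, the conclusion is the
PERIODIC conjunct per potential, carried to the Dirichlet conjunct by the route's own crux `BoundaryTransferWeak`
(stmt-0827) BY NAME, and using the route's support `ShortDistanceCoherence` (stmt-11789) BY NAME):
* `stub_secondMomentFloor` (S1, provable now, M) — the exact Cauchy–Schwarz/IBP inequality above for every real
  periodic `C¹` state: `(N|k|²)² ≤ (N S_k)(4D_k + N|k|⁴(2 − S_k))`.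
* `stub_forceStructureBound` (S2, LOAD-BEARING, crux-strength) — for positive minimisers of BOUNDED admissible `v` of
  range `≤ R` on the torus of side `((n+1)/ρ)^{1/3}`: `D_k ≤ C_R ρ |k|² (n+1)` for all `k ≠ 0`, with `C_R, ρ₀(R), N₀`
  depending on `R` only (dilute, `∀ᶠ n` BEFORE `∀ v`).
* `stub_uniformLevyBound` (S3, crux-strength; = the route's rank-2 crux `InfraredMinimumUncertainty`, stmt-11784, with
  its constant uniform over bounded `v` of range `≤ R`) — `N ν_m S_m ≤ C_R`.
* `stub_uniformChainGlue` (S4, L) — the route's `IMUChainGlue` steps (i)–(vi) with `PuffFloor` replaced by the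
  quadratic floor and every constant `R`-uniform (kinetic budget `T/N ≤ E₀^per(HS_{2R})/N` by monotonicity in `v` +
  `LSSY2005_upperBound_periodic_holds` at the ONE potential `hardCorePotential (2R)`, triage (S1)): quadratic floor →
  uniform Lévy bound → `ShortDistanceCoherence` → minimiser BEC `n₀ ≥ cN` uniformly over the bounded class.
* `stub_diluteClustering` (S5, L) — at low density and for all large `N`, the periodic ground-state energy of an
  admissible `v` (hard cores allowed) is finite and its ground state is VARIATIONALLY SIMPLE: `δ`-near-minimisers are
  mutually `L²(cell^N)`-close up to a phase (Cauchy form: no ground-state object, so not vacuous on hard cores, whose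
  ground state is Lipschitz but not `C¹`). Bonded-sector gap `≥ 2π²/R² − O(ρR)` + connectivity of the dilute hard-set
  configuration space + fixed-`N` compactness. This is the guard Disproof §7 demands.
* `stub_boundedPositiveMinimiser` (S6, known in print, L in tree) — bounded admissible `v`: the periodic `(n+1)`-body
  energy has a strictly positive real `C¹` minimiser of finite energy (compact resolvent, Perron–Frobenius,
  `W^{2,p} ⊂ C^{1,α}`); the periodic twin of the route's `PositiveMinimiser` without `C³`.
* `stub_truncationTransfer` (S7, L) — at fixed `(N, L)`: finite energy + clustering for `v` and positive minimisers of
  EVERY truncation `min(v,n)` with `n₀ ≥ cN` give `n₀ ≥ (c−ε)N` for all `δ`-near-minimisers of `v` (monotone form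
  convergence + Rellich on the torus + `C¹`-core density for the hard set (Hedberg, radial codimension-1 singular
  sets) + `L²`-Lipschitz continuity of `condensateOccupation`).
* `uniformQuadraticFloor` (PROVED here from S1 + S2: the engine's algebra, kernel-checked) and
  `HardCoreExtension_of : ShortDistanceCoherence → BoundaryTransferWeak → HardCoreExtension` (no `sorry` of its own).

Disproof.lean (gen 2) honoured: §1 (`not_crux_iff`, `crux_of_conjunct`) — the skeleton proves the periodic conjunct
for every admissible `v` and never touches `A` (honest shape, stated); §3 (`not_hasGroundStateBEC_hardCorePotential`,
landed `Negative/HighDensityObstruction`) — every stub is dilute: `ρ₀(R)` in S2–S4, `ρ₁(v)` in S5, nothing is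
density-uniform; §4 (`not_hasGroundStateBEC_mono_potential`, `not_condensateNumber_mono_potential`) — no monotonicity
of BEC in `v` is used anywhere; only ENERGIES are compared in `v` (S4's kinetic budget, S7's `E₀(v_n) ↑`); §6 / landed
`Negative/ScalingReductions` (`not_conjunctClass_uniformRho`, `smoothClass_uniformRho_iff_allDensities`) and
`Negative/UniformRepairNormalForm` (`uniformSmoothBEC_iff_unitRange`) — every uniform stub FIXES A LENGTH `R` (class of
range `≤ R`, `a ≤ R` automatic) and puts `ρ₀` after `R`, never `∃ρ₀ ∀v` over a scale-free class; one genuine parameter;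
§7 (`not_monotoneLimitTransfer`, sorried paper refutation: tuned degenerate hard shell at `N = 2`) — S7 carries the
variational-simplicity hypothesis (the disprover's repair `Levers.MonotoneLimitTransferSimple`, re-typed in Cauchy form
because a `C¹` attractor `Ψ₀` does not exist for hard cores) and S5 discharges it only in the dilute thermodynamic boxes;
§8 — S1 = `IdeatorTwo.SecondMomentFloor` ("TRUE on paper"), S2 = `UniformCurrentFluctuationBound` ("CRUX-STRENGTH"),
`finiteEnergyAtLowDensity` (proved, Dirichlet) is the model for the finiteness clause of S5. No stub is an instance of a
landed `Negative/*` lemma (all three files imported and checked below).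
-/

noncomputable section

namespace Summit.AtomisticToContinuum.BoseEinsteinCondensation.Cruxes.HardCoreExtension.ThirdLawCurrentFloor

open MeasureTheory Filter
open scoped ENNReal NNReal BigOperators
open Literature.MathematicalPhysics.QuantumManyBody.BoseGas
open Summit.AtomisticToContinuum.BoseEinsteinCondensation.Theses.BECConjugateDomination

set_option linter.unusedVariables false

/-! ## S1 — the second-moment floor (exact, every real periodic state; provable now) -/

/-- **S1 `stub_secondMomentFloor`.** For every REAL periodic `C¹` state `Ψ` of `n+1` bosons on the torus of side
`L > 0` and every `m ∈ ℤ³∖0`, with `k = 2πm/L`, `S = (n+1)⁻¹∫|Σ_j e_m(x_j)|²|Ψ|²` and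
`D = ∫|Σ_j e_m(x_j)·(k·∇_j)Ψ|²`: `((n+1)|k|²)² ≤ ((n+1)S)·(4D + (n+1)|k|⁴(2 − S))`.
Why true: `A := Σ_j e_m(x_j)(|k|²Ψ − 2i(k·∇_j)Ψ)`; `k·∇_j(ρ_{−k}e^{ik·x_j}) = i|k|²(ρ_{−k}e^{ik·x_j} − 1)` and one
integration by parts of `Ψ²` on the cell (`integral_cell_fderiv_eq_zero`, `fderiv_cellWave_apply_single`,
`norm_cellWave`) give `Re⟨ρ_kΨ, A⟩ = (n+1)|k|²` and `‖A‖² = 4D + (n+1)|k|⁴(2 − S)` identically; then Cauchy–Schwarz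
(`‖ρ_kΨ‖² = (n+1)S`). Verified numerically to `1e−15` by two triagers. `k·∇_jΨ = fderiv ℝ Ψ X (Pi.single j k)`.
Equivalent: `|k|⁴(1−S)² ≤ 4SD/(n+1)`. Size M. [card (I)–(III); Lipparini2008 §8.4; Stringari1995 §2.3] -/
theorem stub_secondMomentFloor :
    ∀ (n : ℕ) (L : ℝ), 0 < L → ∀ Ψ : PeriodicTrialState (n + 1) L,
      (∀ X, Ψ.ψ X = (((Ψ.ψ X).re : ℝ) : ℂ)) →
      ∀ m : Fin 3 → ℤ, m ≠ 0 →
        (((n : ℝ) + 1) * ‖(2 * Real.pi / L) • latticeVec 1 m‖ ^ 2) ^ 2 ≤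
          (((n : ℝ) + 1) *
              (((n : ℝ) + 1)⁻¹ *
                ∫ X in cellN (n + 1) L,
                  ‖∑ j : Fin (n + 1), cellWave L m (X j)‖ ^ 2 * ‖Ψ.ψ X‖ ^ 2)) *
            (4 * (∫ X in cellN (n + 1) L,
                    ‖∑ j : Fin (n + 1), cellWave L m (X j) *
                        fderiv ℝ Ψ.ψ X (Pi.single j ((2 * Real.pi / L) • latticeVec 1 m))‖ ^ 2) +
              ((n : ℝ) + 1) * ‖(2 * Real.pi / L) • latticeVec 1 m‖ ^ 4 *
                (2 - ((n : ℝ) + 1)⁻¹ *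
                  ∫ X in cellN (n + 1) L,
                    ‖∑ j : Fin (n + 1), cellWave L m (X j)‖ ^ 2 * ‖Ψ.ψ X‖ ^ 2)) := by
  sorry

/-! ## S2 — the force-structure bound (CFB), uniform over bounded potentials of range `≤ R` (LOAD-BEARING) -/

/-- **S2 `stub_forceStructureBound` (CFB, the card's Transfer `C⁺`, load-bearing and hardest NEW input).** For every
range bound `R > 0` there are `C > 0`, `ρ₀ > 0` such that for `0 < ρ < ρ₀` and all large `n` (chosen BEFORE the
potential), for every BOUNDED admissible `v` of range `≤ R` and every positive real minimiser `Ψ` of the periodic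
`(n+1)`-body energy on the torus of side `L = ((n+1)/ρ)^{1/3}`, for every `m ≠ 0`, `k = 2πm/L`:
`D_k = ∫|Σ_j e_m(x_j)(k·∇_j)Ψ|² ≤ C ρ |k|² (n+1)`, i.e. the force structure factor `D_k/((n+1)|k|²)` is bounded by
the energy scale `ρR ≥ ρa(v)` uniformly in `k`, `n` and `v`. Why plausibly true: diagonal part `= |k|²T/3 ≤
|k|²E₀^per(HS_{2R})/3 = O(ρR)|k|²(n+1)` (Dyson–LSSY); `D_0 = 0` exactly (`Σ_j∇_jΨ = 0`); Bogoliubov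
`D_k/((n+1)|k|²) = |k|²n_k + O(LHY) ≤ 0.0858·8πρa`; the hard-core limit is FINITE (`Ψ` Lipschitz, `D` first order in
`∇Ψ`) — unlike Puff's `m₃`; Tonks gas saturates S1 with it in `d = 1` (dimension-blind, as the barriers demand).
Why it might fail: it is an infrared statement of BEC calibre (its occupation twin `n_k ≤ Cρa/k²` sums to BEC in
`d = 3`; triage r1-2); the off-diagonal pair-gradient correlation is not energy-controlled (crude Cauchy–Schwarz is
off by a factor `n+1`). Degenerate members: `v = 0` ⇒ constant minimiser, `D = 0 ≤ RHS` ✓; NOT certifying BEC by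
itself (boosted cat states satisfy it). Size XL. [card CFB; LSSY2005 Thm 2.2; Griffin1993 §6.1; same object as
stmt-14622 `LongitudinalForceBound` of route BECDipoleTransport, there derived FROM Puff] -/
theorem stub_forceStructureBound :
    ∀ R : ℝ, 0 < R → ∃ C : ℝ, 0 < C ∧ ∃ ρ₀ : ℝ, 0 < ρ₀ ∧ ∀ ρ : ℝ, 0 < ρ → ρ < ρ₀ →
      ∀ᶠ n : ℕ in atTop, ∀ v : ℝ → ℝ≥0∞, IsRepulsiveFiniteRange v →
        (∃ M : ℝ≥0∞, M ≠ ⊤ ∧ ∀ r, v r ≤ M) → (∀ r, R < r → v r = 0) →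
        ∀ Ψ : PeriodicTrialState (n + 1) (sideLength ρ (n + 1)),
          periodicEnergy v Ψ = periodicGroundStateEnergy v (n + 1) (sideLength ρ (n + 1)) →
          periodicEnergy v Ψ ≠ ⊤ → (∀ X, Ψ.ψ X = (‖Ψ.ψ X‖ : ℂ)) → (∀ X, Ψ.ψ X ≠ 0) →
          ∀ m : Fin 3 → ℤ, m ≠ 0 →
            (∫ X in cellN (n + 1) (sideLength ρ (n + 1)),
                ‖∑ j : Fin (n + 1), cellWave (sideLength ρ (n + 1)) m (X j) *
                    fderiv ℝ Ψ.ψ X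
                      (Pi.single j ((2 * Real.pi / sideLength ρ (n + 1)) • latticeVec 1 m))‖ ^ 2) ≤
              C * ρ * ‖(2 * Real.pi / sideLength ρ (n + 1)) • latticeVec 1 m‖ ^ 2 * ((n : ℝ) + 1) := by
  sorry

/-! ## S3 — the Lévy-weight × structure-factor bound, uniform over bounded potentials of range `≤ R` -/

/-- **S3 `stub_uniformLevyBound`** (= the route's rank-2 crux `InfraredMinimumUncertainty`, stmt-11784, with the
constant uniform over the BOUNDED admissible class of range `≤ R`; the smooth-class regularity of 11784 is not needed
once Puff is gone). For every `R > 0` there are `C ≥ 0`, `ρ₀ > 0` such that for `0 < ρ < ρ₀`, all large `n`, every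
bounded admissible `v` of range `≤ R` and every positive real minimiser `Ψ` on the torus of side `((n+1)/ρ)^{1/3}`:
`(n+1)·ν_m·S_m ≤ C` for all `m ≠ 0`, where `g(r) = ∫_cell∫_{cell^n} Ψ(x+r,Y)Ψ(x,Y)` (translation-averaged one-body
density matrix / ρ), `ν_m = Re ĉ_m(log g)` (Lévy weights), `S_m` the static structure factor — verbatim the objects of
11784. Why plausibly true: Bogoliubov `C = ¼` at every `k`, every `v` (n₀-free); Gavoret–Nozières phonon saturation
`Π → ¼`; `v = 0`: `g ≡ 1`, `ν = 0` ✓. Why it might fail: it is the `1/|k|` law from above (11784's own risk) AND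
uniformity of `C, ρ₀, N₀` along `v_n ↑ ⊤·1_{r<a}` (the one uniformity the transfer needs; §6 of the Disproof allows
it because the length `R` is fixed). Size XL (shared with 11784). [Stringari1995 §2.2; PitaevskiiStringari1991;
MoraCastin2003 §4.3; GavoretNozieres1964] -/
theorem stub_uniformLevyBound :
    ∀ R : ℝ, 0 < R → ∃ C : ℝ, 0 ≤ C ∧ ∃ ρ₀ : ℝ, 0 < ρ₀ ∧ ∀ ρ : ℝ, 0 < ρ → ρ < ρ₀ →
      ∀ᶠ n : ℕ in atTop, ∀ v : ℝ → ℝ≥0∞, IsRepulsiveFiniteRange v →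
        (∃ M : ℝ≥0∞, M ≠ ⊤ ∧ ∀ r, v r ≤ M) → (∀ r, R < r → v r = 0) →
        ∀ Ψ : PeriodicTrialState (n + 1) (sideLength ρ (n + 1)),
          (let L : ℝ := sideLength ρ (n + 1)
           let g : Space → ℝ := fun r => ∫ x in cell L, ∫ Y in cellN n L,
             ‖Ψ.ψ (Matrix.vecCons (x + r) Y)‖ * ‖Ψ.ψ (Matrix.vecCons x Y)‖
           let ν : (Fin 3 → ℤ) → ℝ := fun m =>
             (cellFourierCoeff L (fun r : Space => ((Real.log (g r) : ℝ) : ℂ)) m).re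
           let S : (Fin 3 → ℤ) → ℝ := fun m => ((n : ℝ) + 1)⁻¹ *
             ∫ X in cellN (n + 1) L, ‖∑ j : Fin (n + 1), cellWave L m (X j)‖ ^ 2 * ‖Ψ.ψ X‖ ^ 2
           periodicEnergy v Ψ = periodicGroundStateEnergy v (n + 1) L → periodicEnergy v Ψ ≠ ⊤ →
           (∀ X, Ψ.ψ X = (‖Ψ.ψ X‖ : ℂ)) → (∀ X, Ψ.ψ X ≠ 0) →
           ∀ m : Fin 3 → ℤ, m ≠ 0 → ((n : ℝ) + 1) * ν m * S m ≤ C) := by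
  sorry

/-! ## S4 — the uniform chain glue (route `IMUChainGlue` with the quadratic floor and `R`-uniform constants) -/

/-- **S4 `stub_uniformChainGlue`.** HYPOTHESES: (1) the uniform quadratic floor `min(½, |k|²/(16Cρ)) ≤ S_m`
(proved below from S1 + S2, `uniformQuadraticFloor`); (2) the uniform Lévy bound (S3); (3) the route's
`ShortDistanceCoherence` (stmt-11789) BY NAME. CONCLUSION: for every `R > 0` there is `ρ₀ > 0` such that for
`0 < ρ < ρ₀` there is `c > 0` with: for all large `N`, for every bounded admissible `v` of range `≤ R` and every
positive real minimiser `Ψ` on the torus of side `(N/ρ)^{1/3}`: `n₀(Ψ) ≥ cN` (`condensateOccupation`). Why true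
(bookkeeping of the route's glue, steps (i)–(vi), constants now `R`-uniform): (i) `n₀(Ψ)/N = V⁻¹∫_cell g` for
`Ψ > 0`; (ii) Jensen `log(V⁻¹∫g) ≥ ĉ₀(log g)`; (iii) Parseval with `φ = V·η_κ∗η_κ̃`: `ĉ₀(log g) = V⁻¹∫φ log g −
Σ_{m≠0}|η̂(k/κ)|²ν_m`; (iv) `ShortDistanceCoherence` + `T ≤ E₀^per(v) ≤ E₀^per(hardCorePotential(2R))` (every `v`
of range `≤ R` is `≤ ⊤·1_{r<2R}` pointwise; `periodicEnergy` is monotone in `v`) `≤ 8πRρN(1+o(1))`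
(`LSSY2005_upperBound_periodic_holds` at that ONE potential, `scatteringLength_hardCorePotential`; triage (S1)) give
`V⁻¹∫φ log g ≥ log(1 − C'_R/K²)`, `κ = K√ρ`; (v) (2)+(1): `ν_m ≤ (C_I/N)·max(2, 16C_Fρ/|k|²)` and the `d = 3` lattice
sums `Σ_m|η̂(k/κ)|² ≤ c_ηVκ³`, `Σ_{m≠0}|η̂(k/κ)|²/|k|² ≤ c'_ηVκ` (finite at the origin iff `d ≥ 3`: the dimension
enters here) give `Σ_{m≠0}|η̂|²ν_m ≤ C_I(2c_ηK³ + 16C_Fc'_ηK)√ρ`; (vi) `K` large then `ρ₀(R)` small: `n₀ ≥ N/2`.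
The index shift `n+1 ↦ N` is a filter triviality. Size L (Parseval/Jensen/lattice counting on the cell).
[route IMUChainGlue (stmt-11790); Stringari1995; MoraCastin2003; LSSY2005 Thm 2.2] -/
theorem stub_uniformChainGlue :
    (∀ R : ℝ, 0 < R → ∃ C : ℝ, 0 < C ∧ ∃ ρ₀ : ℝ, 0 < ρ₀ ∧ ∀ ρ : ℝ, 0 < ρ → ρ < ρ₀ →
      ∀ᶠ n : ℕ in atTop, ∀ v : ℝ → ℝ≥0∞, IsRepulsiveFiniteRange v →
        (∃ M : ℝ≥0∞, M ≠ ⊤ ∧ ∀ r, v r ≤ M) → (∀ r, R < r → v r = 0) →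
        ∀ Ψ : PeriodicTrialState (n + 1) (sideLength ρ (n + 1)),
          periodicEnergy v Ψ = periodicGroundStateEnergy v (n + 1) (sideLength ρ (n + 1)) →
          periodicEnergy v Ψ ≠ ⊤ → (∀ X, Ψ.ψ X = (‖Ψ.ψ X‖ : ℂ)) → (∀ X, Ψ.ψ X ≠ 0) →
          ∀ m : Fin 3 → ℤ, m ≠ 0 →
            min (1 / 2 : ℝ)
                (‖(2 * Real.pi / sideLength ρ (n + 1)) • latticeVec 1 m‖ ^ 2 / (16 * C * ρ)) ≤
              ((n : ℝ) + 1)⁻¹ *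
                ∫ X in cellN (n + 1) (sideLength ρ (n + 1)),
                  ‖∑ j : Fin (n + 1), cellWave (sideLength ρ (n + 1)) m (X j)‖ ^ 2 * ‖Ψ.ψ X‖ ^ 2) →
    (∀ R : ℝ, 0 < R → ∃ C : ℝ, 0 ≤ C ∧ ∃ ρ₀ : ℝ, 0 < ρ₀ ∧ ∀ ρ : ℝ, 0 < ρ → ρ < ρ₀ →
      ∀ᶠ n : ℕ in atTop, ∀ v : ℝ → ℝ≥0∞, IsRepulsiveFiniteRange v →
        (∃ M : ℝ≥0∞, M ≠ ⊤ ∧ ∀ r, v r ≤ M) → (∀ r, R < r → v r = 0) →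
        ∀ Ψ : PeriodicTrialState (n + 1) (sideLength ρ (n + 1)),
          (let L : ℝ := sideLength ρ (n + 1)
           let g : Space → ℝ := fun r => ∫ x in cell L, ∫ Y in cellN n L,
             ‖Ψ.ψ (Matrix.vecCons (x + r) Y)‖ * ‖Ψ.ψ (Matrix.vecCons x Y)‖
           let ν : (Fin 3 → ℤ) → ℝ := fun m =>
             (cellFourierCoeff L (fun r : Space => ((Real.log (g r) : ℝ) : ℂ)) m).re
           let S : (Fin 3 → ℤ) → ℝ := fun m => ((n : ℝ) + 1)⁻¹ *
             ∫ X in cellN (n + 1) L, ‖∑ j : Fin (n + 1), cellWave L m (X j)‖ ^ 2 * ‖Ψ.ψ X‖ ^ 2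
           periodicEnergy v Ψ = periodicGroundStateEnergy v (n + 1) L → periodicEnergy v Ψ ≠ ⊤ →
           (∀ X, Ψ.ψ X = (‖Ψ.ψ X‖ : ℂ)) → (∀ X, Ψ.ψ X ≠ 0) →
           ∀ m : Fin 3 → ℤ, m ≠ 0 → ((n : ℝ) + 1) * ν m * S m ≤ C)) →
    ShortDistanceCoherence →
    ∀ R : ℝ, 0 < R → ∃ ρ₀ : ℝ, 0 < ρ₀ ∧ ∀ ρ : ℝ, 0 < ρ → ρ < ρ₀ → ∃ c : ℝ, 0 < c ∧
      ∀ᶠ N : ℕ in atTop, ∀ v : ℝ → ℝ≥0∞, IsRepulsiveFiniteRange v →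
        (∃ M : ℝ≥0∞, M ≠ ⊤ ∧ ∀ r, v r ≤ M) → (∀ r, R < r → v r = 0) →
        ∀ Ψ : PeriodicTrialState N (sideLength ρ N),
          periodicEnergy v Ψ = periodicGroundStateEnergy v N (sideLength ρ N) →
          periodicEnergy v Ψ ≠ ⊤ → (∀ X, Ψ.ψ X = (‖Ψ.ψ X‖ : ℂ)) → (∀ X, Ψ.ψ X ≠ 0) →
          ENNReal.ofReal (c * N) ≤ condensateOccupation N (sideLength ρ N) Ψ.ψ := by
  sorry

/-! ## S5 — dilute variational simplicity (the guard Disproof §7 demands), Cauchy form -/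

/-- **S5 `stub_diluteClustering`.** For every admissible `v` (hard cores, shells, `⊤` allowed) there is `ρ₁ > 0`
such that for `0 < ρ < ρ₁` and all large `N`, on the torus of side `L = (N/ρ)^{1/3}`: the periodic ground-state
energy is finite, and for every `η > 0` there is `δ > 0` such that any two `δ`-near-minimisers `Φ, Φ'` satisfy
`∫_{cell^N}|Φ − e^{iθ}Φ'|² ≤ η` for some phase `θ`. Stated WITHOUT a ground-state object: the hard-core ground state
is Lipschitz, not `C¹`, so "near-minimisers approach a fixed `Ψ₀ : PeriodicTrialState`" would be unsatisfiable there.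
Why plausibly true: finiteness — separated-bump periodic product states for `ρ(1+R)³ < 1` (Dirichlet twin PROVED:
`Negative.finiteEnergyAtLowDensity`, `limsup_lt_top_of_small`); simplicity — at fixed `(N, L)` the form has compact
resolvent (Rellich on the torus), so clustering ⟺ the bottom of the form spectrum is simple; a cavity/bonded pair
costs `≥ 2π²/R² − O(ρR)` uniformly in `N` while the all-free sector costs `O(ρR)` per particle, so for `ρR³` small the
ground state lives in the all-free sector, whose configuration space (dilute hard set of radius `≤ R`) is connected ⇒
positivity improving ⇒ simple (triage r1-3 gen 2, note (3)). Why it might fail: connectivity of the dilute hard-sphere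
configuration space on the torus and the sector gap are folklore, unproved in this generality; exotic `⊤`-sets.
Degenerate: `v = 0` (gap `(2π/L)²` ✓), `N ≤ 1` ✓; the tuned degenerate shell of Disproof §7 sits at `(N,L) = (2,1)`,
outside `ρ < ρ₁(v)`, `∀ᶠ N`. Size L. [ReedSimonIV1978 XIII.12/XIII.47; LSSY2005 Ch. 2; Disproof §7] -/
theorem stub_diluteClustering :
    ∀ v : ℝ → ℝ≥0∞, IsRepulsiveFiniteRange v →
      ∃ ρ₁ : ℝ, 0 < ρ₁ ∧ ∀ ρ : ℝ, 0 < ρ → ρ < ρ₁ → ∀ᶠ N : ℕ in atTop,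
        periodicGroundStateEnergy v N (sideLength ρ N) ≠ ⊤ ∧
        ∀ η : ℝ, 0 < η → ∃ δ : ℝ≥0∞, 0 < δ ∧ ∀ Φ Φ' : PeriodicTrialState N (sideLength ρ N),
          periodicEnergy v Φ ≤ periodicGroundStateEnergy v N (sideLength ρ N) + δ →
          periodicEnergy v Φ' ≤ periodicGroundStateEnergy v N (sideLength ρ N) + δ →
          ∃ θ : ℝ, ∫ X in cellN N (sideLength ρ N),
              ‖Φ.ψ X - Complex.exp (θ * Complex.I) * Φ'.ψ X‖ ^ 2 ≤ η := by
  sorry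

/-! ## S6 — positive `C¹` minimisers for BOUNDED potentials (periodic twin of `PositiveMinimiser`, no `C³`) -/

/-- **S6 `stub_boundedPositiveMinimiser`.** For every BOUNDED admissible `v`, every `n` and `L > 0`, the periodic
`(n+1)`-body energy on the torus of side `L` has a minimiser in the `C¹` periodic Bose class which has finite energy
and is pointwise strictly positive (written `Ψ = ‖Ψ‖ ≠ 0`). Why true (known in print): `V = Σ v^per(x_i−x_j)` is
bounded (finite range ⇒ finitely many images), `−Δ + V` on the torus has compact resolvent and a positivity-improving
semigroup ⇒ unique strictly positive ground state, which is `W^{2,p}` for all `p` hence `C^{1,α}` (no `C³`: `v` is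
only measurable), Bose-symmetric by uniqueness, attains the infimum over the `C¹` core. The Dirichlet twin is PROVED
in the tree (`GroundStateFeynmanKac_holds`, grounder g25-50 on stmt-11787). Needed so that S7's hypothesis is
instantiated by genuine states. Size L (periodic port of the Feynman–Kac/Perron–Frobenius files).
[ReedSimonIV1978 XIII.47; LSSY2005; route PositiveMinimiser stmt-11787] -/
theorem stub_boundedPositiveMinimiser :
    ∀ v : ℝ → ℝ≥0∞, IsRepulsiveFiniteRange v → (∃ M : ℝ≥0∞, M ≠ ⊤ ∧ ∀ r, v r ≤ M) →
      ∀ (n : ℕ) (L : ℝ), 0 < L → ∃ Ψ : PeriodicTrialState (n + 1) L,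
        periodicEnergy v Ψ = periodicGroundStateEnergy v (n + 1) L ∧ periodicEnergy v Ψ ≠ ⊤ ∧
        (∀ X, Ψ.ψ X = (‖Ψ.ψ X‖ : ℂ)) ∧ (∀ X, Ψ.ψ X ≠ 0) := by
  sorry

/-! ## S7 — transfer along the bounded truncations `min(v, n) ↑ v` at fixed `(N, L)` -/

/-- **S7 `stub_truncationTransfer`.** At FIXED `(N, L)`, for an admissible `v` with finite periodic ground-state
energy whose near-minimisers cluster (variational simplicity, S5's clause): if for every truncation height `n` the
bounded potential `v_n = min(v, n)` has a positive real minimiser with `n₀ ≥ cN`, then for every `ε > 0` some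
`δ > 0` makes every `δ`-near-minimiser of `v` itself satisfy `n₀ ≥ (c − ε)N`. Why true on paper: the minimisers
`Ψ_n` have energy `≤ E₀(v) < ⊤`, hence (Rellich on the torus) an `L²(cell^N)`-limit point `Ψ_∞ ≥ 0` with
`q_v(Ψ_∞) ≤ sup_n E₀(v_n) ≤ E₀(v)` (monotone convergence + lower semicontinuity of the closed forms, Simon 1978 /
Kato VIII.3.13a); density of the `C¹` periodic Bose core in the form domain `{∫V|ψ|² < ∞}` (for the `⊤`-set:
Hedberg's synthesis — the singular sets `|x_i − x_j| ∈ K` are unions of codimension-1 spheres, capacity-thick wherever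
they have positive measure nearby) makes `Ψ_∞` a form ground state approximable in energy by `C¹` near-minimisers;
clustering then puts every `δ`-near-minimiser `L²`-close to `e^{iθ}Ψ_∞`; `condensateOccupation` is `2N`-Lipschitz on
the unit sphere of `L²(cell^N)` and phase invariant, and `n₀(Ψ_n) → n₀(Ψ_∞)`. Why it might fail: a `⊤`-set for which
the `C¹` infimum exceeds the form bottom (then `Ψ_∞` is not what `C¹` near-minimisers approach) — excluded on paper by
the radial codimension-1 structure, delicate in general. Junk read-back: `c ≤ 0` trivial; `c > 1` vacuous
(`n₀ ≤ N`); bounded `v`: `v_n = v` eventually ✓; Disproof §7's degenerate shell violates the clustering hypothesis ✓.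
Size L. [Simon1978 monotone forms; ReedSimonIV1978; AdamsHedberg1996 Thm 9.1.3; Disproof §7 / Levers.MonotoneLimitTransferSimple] -/
theorem stub_truncationTransfer :
    ∀ v : ℝ → ℝ≥0∞, IsRepulsiveFiniteRange v → ∀ (N : ℕ) (L : ℝ), 0 < L →
      periodicGroundStateEnergy v N L ≠ ⊤ →
      (∀ η : ℝ, 0 < η → ∃ δ : ℝ≥0∞, 0 < δ ∧ ∀ Φ Φ' : PeriodicTrialState N L,
          periodicEnergy v Φ ≤ periodicGroundStateEnergy v N L + δ →
          periodicEnergy v Φ' ≤ periodicGroundStateEnergy v N L + δ →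
          ∃ θ : ℝ, ∫ X in cellN N L, ‖Φ.ψ X - Complex.exp (θ * Complex.I) * Φ'.ψ X‖ ^ 2 ≤ η) →
      ∀ c : ℝ,
        (∀ n : ℕ, ∃ Ψ : PeriodicTrialState N L,
            periodicEnergy (fun r => min (v r) (n : ℝ≥0∞)) Ψ =
              periodicGroundStateEnergy (fun r => min (v r) (n : ℝ≥0∞)) N L ∧
            periodicEnergy (fun r => min (v r) (n : ℝ≥0∞)) Ψ ≠ ⊤ ∧
            (∀ X, Ψ.ψ X = (‖Ψ.ψ X‖ : ℂ)) ∧ (∀ X, Ψ.ψ X ≠ 0) ∧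
            ENNReal.ofReal (c * N) ≤ condensateOccupation N L Ψ.ψ) →
        ∀ ε : ℝ, 0 < ε → ∃ δ : ℝ≥0∞, 0 < δ ∧ ∀ Φ : PeriodicTrialState N L,
          periodicEnergy v Φ ≤ periodicGroundStateEnergy v N L + δ →
          ENNReal.ofReal ((c - ε) * N) ≤ condensateOccupation N L Φ.ψ := by
  sorry

/-! ## Small proved helpers for the composition -/

/-- `L_N = (N/ρ)^{1/3} > 0` for `ρ > 0`, `N ≥ 1`. [folklore] -/
theorem sideLength_pos' {ρ : ℝ} (hρ : 0 < ρ) {N : ℕ} (hN : 0 < N) : 0 < sideLength ρ N := by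
  unfold sideLength
  apply Real.rpow_pos_of_pos
  exact div_pos (Nat.cast_pos.2 hN) hρ

/-- A nonzero integer vector is a nonzero lattice vector of `ℤ³ ⊂ ℝ³`. [folklore] -/
theorem latticeVec_one_ne_zero {m : Fin 3 → ℤ} (hm : m ≠ 0) : latticeVec 1 m ≠ 0 := by
  intro h
  apply hm
  funext k
  have hk : latticeVec 1 m k = 1 * (m k : ℝ) := rfl
  rw [h] at hk
  have hk' : ((m k : ℤ) : ℝ) = 0 := by simpa using hk.symm
  exact_mod_cast hk'

/-- `k = 2πm/L ≠ 0` has positive squared norm. [folklore] -/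
theorem normSq_waveVec_pos {L : ℝ} (hL : 0 < L) {m : Fin 3 → ℤ} (hm : m ≠ 0) :
    0 < ‖(2 * Real.pi / L) • latticeVec 1 m‖ ^ 2 := by
  have hne : (2 * Real.pi / L) • latticeVec 1 m ≠ 0 :=
    smul_ne_zero (by positivity : (2 * Real.pi / L) ≠ 0) (latticeVec_one_ne_zero hm)
  exact pow_pos (norm_pos_iff.2 hne) 2

/-- The truncation `v_n = min(v, n)` of an admissible potential is admissible (same range). [folklore] -/
theorem isRepulsiveFiniteRange_trunc {v : ℝ → ℝ≥0∞} (hv : IsRepulsiveFiniteRange v) (n : ℕ) :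
    IsRepulsiveFiniteRange (fun r => min (v r) (n : ℝ≥0∞)) := by
  refine ⟨hv.1.min measurable_const, ?_⟩
  obtain ⟨R₀, hR₀⟩ := hv.2
  refine ⟨R₀, fun r hr => ?_⟩
  show min (v r) (n : ℝ≥0∞) = 0
  rw [hR₀ r hr]
  exact min_eq_left (by simp)

/-- The truncation is bounded by `n < ⊤`. [folklore] -/
theorem trunc_bounded (v : ℝ → ℝ≥0∞) (n : ℕ) :
    ∃ M : ℝ≥0∞, M ≠ ⊤ ∧ ∀ r, min (v r) (n : ℝ≥0∞) ≤ M :=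
  ⟨n, ENNReal.natCast_ne_top n, fun r => min_le_right _ _⟩

/-- The truncation keeps every range bound. [folklore] -/
theorem trunc_range {v : ℝ → ℝ≥0∞} {R : ℝ} (hvR : ∀ r, R < r → v r = 0) (n : ℕ) :
    ∀ r, R < r → min (v r) (n : ℝ≥0∞) = 0 := by
  intro r hr
  rw [hvR r hr]
  exact min_eq_left (by simp)

/-- A nonnegative-real-valued state is real-valued (the form S1 consumes). [folklore] -/
theorem re_form_of_norm_form {N : ℕ} {L : ℝ} (Ψ : PeriodicTrialState N L)
    (h : ∀ X, Ψ.ψ X = (‖Ψ.ψ X‖ : ℂ)) : ∀ X, Ψ.ψ X = (((Ψ.ψ X).re : ℝ) : ℂ) := by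
  intro X
  rw [h X, Complex.ofReal_re]

/-! ## The engine, kernel-checked: S1 + S2 ⇒ the uniform quadratic floor `S_m ≥ min(½, |k|²/(16 C ρ))` -/

/-- **Uniform quadratic floor** (PROVED from S1 and S2; replaces the route's `PuffFloor`): with the constant `C` of the
force-structure bound, every positive real minimiser of every bounded admissible `v` of range `≤ R` has
`S_m ≥ min(½, |k|²/(16Cρ))` at every `m ≠ 0`, for `ρ < ρ₀(R)` and all large `n`. Algebra: S1 and `D ≤ CρK(n+1)`
(`K = |k|²`) give `K(1−S)² ≤ 4CρS`; if `S < ½` then `(1−S)² ≥ ¼`, so `S ≥ K/(16Cρ)`. [card (III) + CFB] -/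
theorem uniformQuadraticFloor :
    ∀ R : ℝ, 0 < R → ∃ C : ℝ, 0 < C ∧ ∃ ρ₀ : ℝ, 0 < ρ₀ ∧ ∀ ρ : ℝ, 0 < ρ → ρ < ρ₀ →
      ∀ᶠ n : ℕ in atTop, ∀ v : ℝ → ℝ≥0∞, IsRepulsiveFiniteRange v →
        (∃ M : ℝ≥0∞, M ≠ ⊤ ∧ ∀ r, v r ≤ M) → (∀ r, R < r → v r = 0) →
        ∀ Ψ : PeriodicTrialState (n + 1) (sideLength ρ (n + 1)),
          periodicEnergy v Ψ = periodicGroundStateEnergy v (n + 1) (sideLength ρ (n + 1)) →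
          periodicEnergy v Ψ ≠ ⊤ → (∀ X, Ψ.ψ X = (‖Ψ.ψ X‖ : ℂ)) → (∀ X, Ψ.ψ X ≠ 0) →
          ∀ m : Fin 3 → ℤ, m ≠ 0 →
            min (1 / 2 : ℝ)
                (‖(2 * Real.pi / sideLength ρ (n + 1)) • latticeVec 1 m‖ ^ 2 / (16 * C * ρ)) ≤
              ((n : ℝ) + 1)⁻¹ *
                ∫ X in cellN (n + 1) (sideLength ρ (n + 1)),
                  ‖∑ j : Fin (n + 1), cellWave (sideLength ρ (n + 1)) m (X j)‖ ^ 2 * ‖Ψ.ψ X‖ ^ 2 := by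
  intro R hR
  obtain ⟨C, hC, ρ₀, hρ₀, h⟩ := stub_forceStructureBound R hR
  refine ⟨C, hC, ρ₀, hρ₀, fun ρ hρ hρ₀' => ?_⟩
  filter_upwards [h ρ hρ hρ₀'] with n hn
  intro v hv hbdd hvR Ψ hmin hfin hreal hpos m hm
  have hD := hn v hv hbdd hvR Ψ hmin hfin hreal hpos m hm
  have hL : 0 < sideLength ρ (n + 1) := sideLength_pos' hρ (Nat.succ_pos n)
  have hS1 := stub_secondMomentFloor n (sideLength ρ (n + 1)) hL Ψ (re_form_of_norm_form Ψ hreal) m hm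
  -- name the atoms (the side length is NOT abbreviated: `Ψ`'s type depends on it)
  set Nr : ℝ := (n : ℝ) + 1 with hNrdef
  set K : ℝ := ‖(2 * Real.pi / sideLength ρ (n + 1)) • latticeVec 1 m‖ ^ 2 with hKdef
  set Sint : ℝ := ∫ X in cellN (n + 1) (sideLength ρ (n + 1)),
      ‖∑ j : Fin (n + 1), cellWave (sideLength ρ (n + 1)) m (X j)‖ ^ 2 * ‖Ψ.ψ X‖ ^ 2 with hSintdef
  set D : ℝ := ∫ X in cellN (n + 1) (sideLength ρ (n + 1)),
      ‖∑ j : Fin (n + 1), cellWave (sideLength ρ (n + 1)) m (X j) *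
          fderiv ℝ Ψ.ψ X (Pi.single j ((2 * Real.pi / sideLength ρ (n + 1)) • latticeVec 1 m))‖ ^ 2
    with hDdef
  have hNr : 0 < Nr := by rw [hNrdef]; positivity
  have hK : 0 < K := by rw [hKdef]; exact normSq_waveVec_pos hL hm
  have hSint : 0 ≤ Sint := by
    rw [hSintdef]
    exact integral_nonneg fun X => by positivity
  have hk4 : ‖(2 * Real.pi / sideLength ρ (n + 1)) • latticeVec 1 m‖ ^ 4 = K ^ 2 := by
    rw [hKdef]; ring
  rw [hk4] at hS1
  -- S := Nr⁻¹ * Sint, the structure factor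
  set S : ℝ := Nr⁻¹ * Sint with hSdef
  have hS0 : 0 ≤ S := by rw [hSdef]; positivity
  have hNS : 0 ≤ Nr * S := by positivity
  -- insert the force-structure bound into S1
  have hS2 : (Nr * K) ^ 2 ≤ (Nr * S) * (4 * (C * ρ * K * Nr) + Nr * K ^ 2 * (2 - S)) := by
    calc (Nr * K) ^ 2 ≤ (Nr * S) * (4 * D + Nr * K ^ 2 * (2 - S)) := hS1
      _ ≤ (Nr * S) * (4 * (C * ρ * K * Nr) + Nr * K ^ 2 * (2 - S)) :=
          mul_le_mul_of_nonneg_left (by linarith [hD]) hNS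
  -- divide by `Nr² K > 0`
  have hid : Nr ^ 2 * K * (K * (1 - S) ^ 2 - 4 * C * ρ * S) =
      (Nr * K) ^ 2 - (Nr * S) * (4 * (C * ρ * K * Nr) + Nr * K ^ 2 * (2 - S)) := by ring
  have hprod : Nr ^ 2 * K * (K * (1 - S) ^ 2 - 4 * C * ρ * S) ≤ 0 := by rw [hid]; linarith
  have hNK : 0 < Nr ^ 2 * K := by positivity
  have hcore : K * (1 - S) ^ 2 - 4 * C * ρ * S ≤ 0 := by
    by_contra hcon
    push Not at hcon
    have := mul_pos hNK hcon
    linarith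
  -- case split on `S ≥ ½`
  rcases le_or_gt (1 / 2 : ℝ) S with hhalf | hhalf
  · exact (min_le_left _ _).trans hhalf
  · refine (min_le_right _ _).trans ?_
    have h16 : 0 < 16 * C * ρ := by positivity
    rw [div_le_iff₀ h16]
    have hq : 0 ≤ K * ((1 - 2 * S) * (3 - 2 * S)) :=
      mul_nonneg hK.le (mul_nonneg (by linarith) (by linarith))
    nlinarith [hcore, hq]

/-! ## The composition: the seven stubs give the crux BY NAME -/

/-- **`HardCoreExtension` from the line `third-law-current-floor`** (kernel-checked; no `sorry` of its own). Hypotheses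
are two ROUTE ITEMS by name: `ShortDistanceCoherence` (stmt-11789, provable now, consumed by S4) and the shared crux
`BoundaryTransferWeak` (stmt-0827, periodic ⇒ Dirichlet BEC per potential, exactly as in the route's `closes`). The
antecedent `A` of the crux is not used (Disproof §1: the honest shape). Proof: fix an admissible `v` with range bound
`R > 0`; S1+S2 (`uniformQuadraticFloor`), S3 and `ShortDistanceCoherence` feed S4, giving `ρ₀(R)`, `c(ρ)` and
minimiser BEC `n₀ ≥ cN` for ALL bounded admissible potentials of range `≤ R`, in particular for every truncation
`min(v, n)` (admissible, bounded by `n`, range `≤ R`), whose positive minimisers S6 supplies; S5 gives `ρ₁(v)`,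
finiteness and clustering for `v`; S7 at `(N, L_N(ρ))` turns these into `n₀ ≥ (c/2)N` for all `δ`-near-minimisers of
`v`, i.e. the periodic BEC hypothesis of `BoundaryTransferWeak v`, which returns dilute `HasGroundStateBEC v ρ`. -/
theorem HardCoreExtension_of (hsdc : ShortDistanceCoherence) (hbt : BoundaryTransferWeak) :
    HardCoreExtension := by
  intro _hA v hv
  obtain ⟨R, hR, hvR⟩ := hv.exists_pos_range
  -- thermodynamic half: minimiser BEC, uniform over bounded admissible potentials of range ≤ R
  obtain ⟨ρ₀, hρ₀, hth⟩ := stub_uniformChainGlue uniformQuadraticFloor stub_uniformLevyBound hsdc R hR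
  -- dilute finiteness + variational simplicity for `v` itself
  obtain ⟨ρ₁, hρ₁, hcl⟩ := stub_diluteClustering v hv
  apply hbt v hv
  refine ⟨min ρ₀ ρ₁, lt_min hρ₀ hρ₁, fun ρ hρ hρlt => ?_⟩
  have hρ₀' : ρ < ρ₀ := hρlt.trans_le (min_le_left _ _)
  have hρ₁' : ρ < ρ₁ := hρlt.trans_le (min_le_right _ _)
  obtain ⟨c, hc, hN⟩ := hth ρ hρ hρ₀'
  refine ⟨c / 2, by positivity, ?_⟩
  filter_upwards [hN, hcl ρ hρ hρ₁', eventually_ge_atTop 1] with N hN₁ hN₂ hN₃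
  obtain ⟨hfin, hclN⟩ := hN₂
  have hL : 0 < sideLength ρ N := sideLength_pos' hρ hN₃
  obtain ⟨k, rfl⟩ : ∃ k, N = k + 1 := ⟨N - 1, by omega⟩
  -- positive minimisers of every truncation (S6), each with the uniform bound (S4)
  have hmin : ∀ n : ℕ, ∃ Ψ : PeriodicTrialState (k + 1) (sideLength ρ (k + 1)),
      periodicEnergy (fun r => min (v r) (n : ℝ≥0∞)) Ψ =
        periodicGroundStateEnergy (fun r => min (v r) (n : ℝ≥0∞)) (k + 1) (sideLength ρ (k + 1)) ∧
      periodicEnergy (fun r => min (v r) (n : ℝ≥0∞)) Ψ ≠ ⊤ ∧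
      (∀ X, Ψ.ψ X = (‖Ψ.ψ X‖ : ℂ)) ∧ (∀ X, Ψ.ψ X ≠ 0) ∧
      ENNReal.ofReal (c * (k + 1 : ℕ)) ≤ condensateOccupation (k + 1) (sideLength ρ (k + 1)) Ψ.ψ := by
    intro n
    obtain ⟨Ψ, h₁, h₂, h₃, h₄⟩ := stub_boundedPositiveMinimiser _ (isRepulsiveFiniteRange_trunc hv n)
      (trunc_bounded v n) k (sideLength ρ (k + 1)) hL
    exact ⟨Ψ, h₁, h₂, h₃, h₄,
      hN₁ _ (isRepulsiveFiniteRange_trunc hv n) (trunc_bounded v n) (trunc_range hvR n) Ψ h₁ h₂ h₃ h₄⟩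
  -- S7 at (N, L_N): near-minimiser BEC for `v` with fraction c - c/2 = c/2
  obtain ⟨δ, hδ, hΦ⟩ := stub_truncationTransfer v hv (k + 1) (sideLength ρ (k + 1)) hL hfin hclN c hmin
    (c / 2) (by positivity)
  refine ⟨δ, hδ, fun Φ hΦE => ?_⟩
  have h := hΦ Φ hΦE
  have hcc : c - c / 2 = c / 2 := by ring
  rw [hcc] at h
  exact h

end Summit.AtomisticToContinuum.BoseEinsteinCondensation.Cruxes.HardCoreExtension.ThirdLawCurrentFloor
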